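import Literature.NumberTheory.QuadraticFields.UnitsModCubes
import Literature.NumberTheory.QuadraticFields.QuadraticDedekindZeta
import Literature.NumberTheory.LFunctions.UniformClassGroupPNTInputs
import HarnessLib

/-!
# `w_K ≤ 9` and `κ_K ≥ 1/(2√|d_K|)` for imaginary quadratic fields

Topic `Literature/NumberTheory/LFunctions`, namespace `Literature.NumberTheory.LFunctions.NumberField`.
Everything here is PROVED (theorems only).

Crude but uniform inputs for the size hypotheses of the log-free zero-density estimates
(`P⁻¹ ≤ κ_K`): for a quadratic field `K` with `d_K < 0`,

* `natCard_units_le_nine` — `#(𝓞 K)ˣ ≤ 9` (a unit `a + bτ` has `(2a + εb)² + |d_K| b² = 4`, so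
  `|b| ≤ 1`, `|a| ≤ 1`: the unit group embeds into `{−1,0,1}²`);
* `torsionOrder_le_nine` — `w_K ≤ 9`;
* `dedekindZeta_residue_ge` — **`κ_K = 2π h_K/(w_K √|d_K|) ≥ 1/(2√|d_K|)`** (Mathlib's class number
  formula `NumberField.dedekindZeta_residue_def`, `R_K = 1`, `r₁ = 0`, `r₂ = 1`, `h_K ≥ 1`), hence
  `κ_K ≥ 1/Q`, `Q = 4|d_K|` (`condQ_inv_le_dedekindZeta_residue`).

## References

* D. A. Cox, *Primes of the form x² + ny²*, §7.A (units of imaginary quadratic orders). [Cox2013]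
* J. Neukirch, *Algebraic Number Theory*, VII (5.11) (class number formula). [NeukirchANT1999]
-/

noncomputable section

open scoped NumberField
open NumberField NumberField.InfinitePlace NumberField.Units Module

namespace Literature.NumberTheory.LFunctions.NumberField

open Literature.NumberTheory.QuadraticFields.Quadratic

variable {K : Type*} [Field K] [NumberField K]

/-- **`#(𝓞 K)ˣ ≤ 9`** for a quadratic field with `d_K < 0`: the coordinates `(a, b)` of a unit in
the basis `(1, τ)` satisfy `|a| ≤ 1`, `|b| ≤ 1`. [cite: Cox2013, §7.A] -/
theorem natCard_units_le_nine (h2 : finrank ℚ K = 2) (hd : NumberField.discr K < 0) :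
    Finite (𝓞 K)ˣ ∧ Nat.card (𝓞 K)ˣ ≤ 9 := by
  obtain ⟨T⟩ := nonempty_tauData h2
  classical
  -- coordinates of a unit
  have hcoord : ∀ u : (𝓞 K)ˣ, ∃ ab : ℤ × ℤ, (u : 𝓞 K) = (ab.1 : 𝓞 K) + (ab.2 : 𝓞 K) * T.τ ∧ |ab.1| ≤ 1 ∧ |ab.2| ≤ 1 := by
    intro u
    obtain ⟨a, b, hab⟩ := T.exists_int_coords (u : 𝓞 K)
    have hN := T.norm_eq_of_coords h2 hab
    have hunit : IsUnit (Algebra.norm ℤ (u : 𝓞 K)) := u.isUnit.map _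
    rw [hN, Int.isUnit_iff] at hunit
    have hDε : NumberField.discr K = T.ε + 4 * T.m := T.discr_eq
    have hε := T.ε_eq
    have key : (2 * a + T.ε * b) ^ 2 - NumberField.discr K * b ^ 2 = 4 * (a ^ 2 + T.ε * a * b - T.m * b ^ 2) := by
      rw [hDε]; rcases hε with h | h <;> rw [h] <;> ring
    have h4 : (2 * a + T.ε * b) ^ 2 - NumberField.discr K * b ^ 2 ≤ 4 := by
      rcases hunit with h | h <;> rw [key, h] <;> norm_num
    have hd3 : NumberField.discr K ≤ -3 := by
      have h := NumberField.abs_discr_gt_two (K := K) (by rw [h2]; norm_num)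
      rw [abs_of_neg hd] at h
      omega
    have hb : |b| ≤ 1 := by
      by_contra hb
      rw [not_le] at hb
      have hb2 : 4 ≤ b ^ 2 := by nlinarith [sq_abs b]
      nlinarith [sq_nonneg (2 * a + T.ε * b)]
    have ha : |a| ≤ 1 := by
      have hd1 : NumberField.discr K ≤ -1 := by omega
      have hsq : (2 * a + T.ε * b) ^ 2 ≤ 4 := by nlinarith [sq_nonneg b]
      have h2a' : -2 ≤ 2 * a + T.ε * b ∧ 2 * a + T.ε * b ≤ 2 := by
        constructor <;> nlinarith [sq_nonneg (2 * a + T.ε * b + 2), sq_nonneg (2 * a + T.ε * b - 2)]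
      have hbb := abs_le.1 hb
      rw [abs_le]
      rcases hε with h | h <;> rw [h] at h2a' <;> constructor <;> omega
    exact ⟨(a, b), hab, ha, hb⟩
  choose φ hφ using hcoord
  have hinj : Function.Injective φ := by
    intro u v huv
    have hu := (hφ u).1
    have hv := (hφ v).1
    rw [huv] at hu
    exact Units.ext (hu.trans hv.symm)
  -- the target box
  set S : Finset (ℤ × ℤ) := (Finset.Icc (-1 : ℤ) 1) ×ˢ (Finset.Icc (-1 : ℤ) 1) with hS
  have hmem : ∀ u, φ u ∈ S := by
    intro u
    obtain ⟨-, ha, hb⟩ := hφ u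
    rw [hS, Finset.mem_product, Finset.mem_Icc, Finset.mem_Icc]
    exact ⟨abs_le.1 ha, abs_le.1 hb⟩
  have hcardS : S.card = 9 := by rw [hS, Finset.card_product]; rfl
  -- `φ` maps injectively into the finite set `S`
  let ψ : (𝓞 K)ˣ → S := fun u ↦ ⟨φ u, hmem u⟩
  have hψ : Function.Injective ψ := fun u v h ↦ hinj (congrArg Subtype.val h)
  have hfin : Finite (𝓞 K)ˣ := Finite.of_injective ψ hψ
  refine ⟨hfin, ?_⟩
  have := Nat.card_le_card_of_injective ψ hψ
  rwa [Nat.card_eq_fintype_card (α := S), Fintype.card_coe, hcardS] at this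

/-- **`w_K ≤ 9`** for a quadratic field with `d_K < 0`. [cite: Cox2013, §7.A] -/
theorem torsionOrder_le_nine (h2 : finrank ℚ K = 2) (hd : NumberField.discr K < 0) : torsionOrder K ≤ 9 := by
  obtain ⟨hfin, hcard⟩ := natCard_units_le_nine h2 hd
  rw [torsionOrder]
  haveI := hfin
  exact (Nat.card_le_card_of_injective (fun x : torsion K ↦ (x : (𝓞 K)ˣ)) Subtype.val_injective).trans hcard

/-- **`κ_K ≥ 1/(2√|d_K|)`** for an imaginary quadratic field (`κ_K = 2π h_K/(w_K √|d_K|)`, `h_K ≥ 1`,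
`w_K ≤ 9`, `2π/9 ≥ 1/2`). [cite: NeukirchANT1999, Ch. VII (5.11)] -/
theorem dedekindZeta_residue_ge (h2 : finrank ℚ K = 2) (hd : NumberField.discr K < 0) :
    1 / (2 * Real.sqrt |(NumberField.discr K : ℝ)|) ≤ dedekindZeta_residue K := by
  obtain ⟨hr₁, hr₂⟩ := Literature.NumberTheory.QuadraticFields.Quadratic.nrRealPlaces_eq_zero_and_nrComplexPlaces_eq_one h2 hd
  have hR := Literature.NumberTheory.QuadraticFields.Quadratic.regulator_eq_one_of_discr_neg h2 hd
  rw [NumberField.dedekindZeta_residue_def, hr₁, hr₂, hR]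
  have hw : (torsionOrder K : ℝ) ≤ 9 := by exact_mod_cast torsionOrder_le_nine h2 hd
  have hw0 : (0 : ℝ) < torsionOrder K := by exact_mod_cast torsionOrder_pos K
  have hh : (1 : ℝ) ≤ classNumber K := by exact_mod_cast classNumber_pos K
  have hdR : 0 < Real.sqrt |(NumberField.discr K : ℝ)| := by
    refine Real.sqrt_pos.2 (abs_pos.2 ?_)
    exact_mod_cast NumberField.discr_ne_zero K
  have hπ : (3 : ℝ) ≤ Real.pi := by have := Real.pi_gt_three; linarith
  rw [div_le_div_iff₀ (by positivity) (by positivity)]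
  simp only [pow_zero, pow_one, one_mul, mul_one]
  -- `w √|d| ≤ 9 √|d| ≤ 2 · 2π · h · √|d|·…`: `1 · (w √|d|) ≤ (2π h) · (2 √|d|)`
  have h1 : (torsionOrder K : ℝ) * Real.sqrt |(NumberField.discr K : ℝ)| ≤ 9 * Real.sqrt |(NumberField.discr K : ℝ)| :=
    mul_le_mul_of_nonneg_right hw hdR.le
  have h2 : 9 * Real.sqrt |(NumberField.discr K : ℝ)| ≤ 2 * Real.pi * (classNumber K : ℝ) * (2 * Real.sqrt |(NumberField.discr K : ℝ)|) := by
    nlinarith [mul_nonneg (by linarith : (0:ℝ) ≤ Real.pi) hdR.le, mul_le_mul_of_nonneg_right hh (by positivity : (0:ℝ) ≤ Real.pi * Real.sqrt |(NumberField.discr K : ℝ)|)]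
  linarith


/-- **`1/Q ≤ κ_K`**, `Q = 4|d_K|`, for an imaginary quadratic field (`2√|d| ≤ 4|d|`). [folklore] -/
theorem condQ_inv_le_dedekindZeta_residue (h2 : finrank ℚ K = 2) (hd : NumberField.discr K < 0) :
    (ThornerZaman.condQ K)⁻¹ ≤ dedekindZeta_residue K := by
  refine le_trans ?_ (dedekindZeta_residue_ge h2 hd)
  rw [ThornerZaman.condQ, one_div]
  have hd1 : (1 : ℝ) ≤ |(NumberField.discr K : ℝ)| := by
    have := NumberField.abs_discr_gt_two (K := K) (by rw [h2]; norm_num)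
    have : (2 : ℝ) < |(NumberField.discr K : ℝ)| := by exact_mod_cast this
    linarith
  have hsqrt : Real.sqrt |(NumberField.discr K : ℝ)| ≤ |(NumberField.discr K : ℝ)| := by
    rw [Real.sqrt_le_left (by linarith)]
    nlinarith
  have hpos : 0 < 2 * Real.sqrt |(NumberField.discr K : ℝ)| := by positivity
  exact inv_anti₀ hpos (by linarith)

end Literature.NumberTheory.LFunctions.NumberField

end
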